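/- Free-seat work of WIDTH SEAT 2/3 `ym-line-cbag-p1-w2` (prover-ym-line-cbag-p1-w2-g16-0), route `EguchiKawaiDirectionLadder`
(ideator ym-idea-2, LINE 8): the route-posited objects of the REGISTERED birth skeleton of crux `DirectionIncrement`
(stmt-QuantumFields-27725; planner ym-idea-2 g6, HOME/l8/bc/DirectionIncrement_birth.lean, skeleton sha d27895d9…) VERBATIM, so that the
two registered stubs `stub_singleLinkRigidity : SingleLinkRigidity` and `stub_fubiniIncrement : FubiniIncrement` can be landed by name from
importable definitions.  Definitions only; no claim.  The route bears on the barrier-ledger fact `EguchiKawaiBreakdown`; the Yang–Mills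
mass gap is NOT proved by anything here. -/
import Summits.QuantumFields.YangMills.Theses.EguchiKawaiDirectionLadder

/-!
# Route `EguchiKawaiDirectionLadder`, crux `DirectionIncrement` (stmt-QuantumFields-27725): the skeleton's objects

The crux `DirectionIncrement`: for every `d ≥ 3`, `0 < δ < 1/2`, `e`, `C`,
`EKSymSmallBallBound d δ e C → ∃ C', EKSymSmallBallBound (d+1) δ (e + (1 − 2δ)/4) C'` — one more reduced direction costs at least the
exponent `(1 − 2δ)/4`, uniformly in `N`.  The registered line of record (planner ym-idea-2 g6) composes it from

* `SingleLinkRigidity` (stub B1, load-bearing): for every centre-symmetric `U ∈ U(N)` (`|tr U/N|² ≤ δ < 1/2`) the Haar measure of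
  `{W : S_R(![U, W]) ≤ t}` — `S_R(![U,W]) = ‖[U,W]‖_F²/(2N)`, the reduced action of the two-link configuration — is at most
  `exp(N²(((1 − 2δ)/4)·log t + C))`, uniformly in `N ≥ N₀` and `t > 0` (`C ≥ 0`);
* `FubiniIncrement` (stub B2): `SingleLinkRigidity → DirectionIncrement` (Fubini over the last factor of `ekHaar (d+1) N` and
  `S_R^{(d+1)} ≥ S_R^{(d)} + S_R(![U₀, U_d])`) — PROVED, content in `EguchiKawaiDirectionLadderFubiniIncrement.lean`
  (`directionIncrement_of_singleLinkRigidity`), by-name one-liner in a sibling file.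

This file only DECLARES these objects, byte-for-byte as in the registered skeleton (namespace moved from
`…Theses.EguchiKawaiDirectionLadder.Birth` to the route's Theorems namespace; `FubiniIncrement` concludes the ROUTE decl
`Theses.EguchiKawaiDirectionLadder.DirectionIncrement`, of which the skeleton's local `DirectionIncrement` is a verbatim copy), plus the
kernel-checked composition `directionIncrement_of_stubs`.  Nothing is claimed; no summit statement and no mass gap is proved by declaring them.
-/

set_option autoImplicit false

noncomputable section

open MeasureTheory
open Literature.Barriers.QuantumFields

namespace Summit.QuantumFields.YangMills.Theorems.EguchiKawaiDirectionLadder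

/-- The two-link reduced configuration `(U, W)` (object of the registered skeleton of stmt-QuantumFields-27725, verbatim). -/
def pairConfig {N : ℕ} (U W : UN N) : EKConfig 2 N := ![U, W]

/-- STUB B1 of the registered skeleton of stmt-QuantumFields-27725 (load-bearing), verbatim: one-matrix rigidity — the Haar measure of
the `W` almost commuting with a centre-symmetric `U` at reduced-action precision `t` has exponent at least `(1 − 2δ)/4`, uniformly in `N`. -/
def SingleLinkRigidity : Prop :=
  ∀ δ : ℝ, 0 < δ → δ < 1 / 2 → ∃ C : ℝ, 0 ≤ C ∧ ∃ N₀ : ℕ, ∀ N : ℕ, N₀ ≤ N → ∀ U : UN N,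
    ‖Matrix.trace (U : Matrix (Fin N) (Fin N) ℂ) / (N : ℂ)‖ ^ 2 ≤ δ → ∀ t : ℝ, 0 < t →
      Literature.MathematicalPhysics.QuantumFieldTheory.haarProbability (UN N)
          {W : UN N | ekAction (pairConfig U W) ≤ t} ≤
        ENNReal.ofReal (Real.exp ((N : ℝ) ^ 2 * ((1 - 2 * δ) / 4 * Real.log t + C)))

/-- STUB B2 of the registered skeleton of stmt-QuantumFields-27725, verbatim up to the namespace of the conclusion: Fubini over the last
factor of `ekHaar (d+1) N` + the action splitting `S_R^{(d+1)} ≥ S_R^{(d)} + S_pair(U₁, U_{d+1})` turn B1 into the crux. -/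
def FubiniIncrement : Prop :=
  SingleLinkRigidity → Summit.QuantumFields.YangMills.Theses.EguchiKawaiDirectionLadder.DirectionIncrement

/-- Composition (as in the registered skeleton's `DirectionIncrement_of`): the two stubs give the route's crux `DirectionIncrement`
by name.  Kernel-checked bookkeeping; nothing is proved about the stubs here. -/
theorem directionIncrement_of_stubs (h₁ : SingleLinkRigidity) (h₂ : FubiniIncrement) :
    Summit.QuantumFields.YangMills.Theses.EguchiKawaiDirectionLadder.DirectionIncrement :=
  h₂ h₁

end Summit.QuantumFields.YangMills.Theorems.EguchiKawaiDirectionLadder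

end
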